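import Summits.Schanuel.Schanuel.Theses.PolarPhantoms

/-!
# Sketch — crux-ideate stmt-Schanuel-6848 (PolarLindemann), ideator 1, round 1

First lemmas of the three idea cards (statements only; they must elaborate, not be proved):

* `ExactLindemann`, `CostCollapse`            — card `cramer-cost-collapse`
* `ConjugatePencil`                           — card `cramer-cost-collapse` (transfer target C⁺⁺ = E_geo)
* `royDerC`, `transl`, `TranslationIsPolynomialInD` — card `fake-exponential-frobenius`
* `OnePointPerfectness`, `TwistedNonVanishing` — card `shadow-surjectivity`
-/

noncomputable section

namespace Summit.Schanuel.Schanuel.Cruxes.PolarLindemann.Ideate1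

open MvPolynomial Filter
open Literature.NumberTheory.Transcendental

/-- (E) EXACT LINDEMANN: at an algebraic point, every non-zero `P` in Roy's DEGREE box (no height
bound) has an EXACT rational certificate `∑ c_{k,m} (D^k P)(m·y, α^m) = 1` on Roy's box, for all
large `N` — no cost bound, no height. Card `cramer-cost-collapse`: `ExactLindemann → PolarLindemann`
(`CostCollapse`) by Cramer's rule in the fixed dimension `g = [ℚ(y,α):ℚ]`. -/
def ExactLindemann : Prop :=
  ∀ (n : ℕ) (y α : Fin n → ℂ), 1 ≤ n → (∀ j, IsAlgebraic ℚ (y j)) → (∀ j, IsAlgebraic ℚ (α j)) →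
    LinearIndependent ℚ y → (∀ j, α j ≠ 0) →
    ∀ s₀ s₁ t₀ t₁ u : ℝ, RoyAdmissible s₀ s₁ t₀ t₁ u →
    ∀ᶠ N : ℕ in atTop, ∀ P : MvPolynomial (Fin 2) ℤ, P ≠ 0 →
      (P.degreeOf 0 : ℝ) ≤ (N : ℝ) ^ t₀ → (P.degreeOf 1 : ℝ) ≤ (N : ℝ) ^ t₁ →
      ∃ c : ℕ → (Fin n → ℕ) → ℚ,
        (∑ k ∈ Finset.range (⌊(N : ℝ) ^ s₀⌋₊ + 1),
          ∑ m ∈ Fintype.piFinset (fun _ : Fin n => Finset.range (⌊(N : ℝ) ^ s₁⌋₊ + 1)),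
            (c k m : ℂ) * MvPolynomial.aeval ![∑ j, ((m j : ℕ) : ℂ) * y j, ∏ j, α j ^ (m j)]
              (royD^[k] P)) = 1

/-- COST COLLAPSE (first lemma of card `cramer-cost-collapse`): exactness implies Roy-cheapness at
algebraic points, because the box values span a `ℚ`-space of dimension `≤ g` inside the number
field, so a certificate can be supported on `≤ g` box values with Cramer coefficients of size
`exp(O(g · N^{max(s₀, s₁+t₁)} · log N + g N)) = e^{o(N^u)}`. -/
def CostCollapse : Prop :=
  ExactLindemann → Summit.Schanuel.Schanuel.Theses.PolarPhantoms.PolarLindemann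

/-- (E_geo) CONJUGATE PENCIL (transfer target C⁺⁺ of card `cramer-cost-collapse`, implies (E)):
for a number field `F ⊂ ℂ`, `y ∈ Fⁿ` `ℚ`-free, `α ∈ (Fˣ)ⁿ`, admissible parameters and all large
`N`: no non-zero COMPLEX polynomial `P` in the degree box and no weight vector `b` on the complex
embeddings `σ : F → ℂ` with `∑_σ b_σ ≠ 0` kill all the weighted conjugate box jets
`∑_σ b_σ (D^k P)(m·σy, σα^m)`.  (For `b = (σ β)_σ`, `P` rational, this is the trace-dual of (E).) -/
def ConjugatePencil : Prop :=
  ∀ (n : ℕ) (F : IntermediateField ℚ ℂ) [FiniteDimensional ℚ F] (y α : Fin n → F), 1 ≤ n →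
    LinearIndependent ℚ y → (∀ j, α j ≠ 0) →
    ∀ s₀ s₁ t₀ t₁ u : ℝ, RoyAdmissible s₀ s₁ t₀ t₁ u →
    ∀ᶠ N : ℕ in atTop, ∀ (P : MvPolynomial (Fin 2) ℂ) (b : (F →ₐ[ℚ] ℂ) → ℂ), P ≠ 0 →
      (P.degreeOf 0 : ℝ) ≤ (N : ℝ) ^ t₀ → (P.degreeOf 1 : ℝ) ≤ (N : ℝ) ^ t₁ → ∑ σ, b σ ≠ 0 →
      ∃ (k : ℕ) (m : Fin n → ℕ), (k : ℝ) ≤ (N : ℝ) ^ s₀ ∧ (∀ j, (m j : ℝ) ≤ (N : ℝ) ^ s₁) ∧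
        ∑ σ, b σ * MvPolynomial.aeval ![∑ j, ((m j : ℕ) : ℂ) * σ (y j), ∏ j, σ (α j) ^ (m j)]
          ((fun Q : MvPolynomial (Fin 2) ℂ => pderiv 0 Q + X 1 * pderiv 1 Q)^[k] P) ≠ 0

/-- Roy's derivation `D = ∂₀ + X₁ ∂₁` over `ℂ` as a `Derivation` (the inhomogeneous version of the
tree's `Roy2013.homD`). -/
def royDerC : Derivation ℂ (MvPolynomial (Fin 2) ℂ) (MvPolynomial (Fin 2) ℂ) :=
  pderiv 0 + (X 1 : MvPolynomial (Fin 2) ℂ) • pderiv 1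

/-- Translation by the point `(ξ, η) ∈ 𝔾ₐ × 𝔾ₘ`: `P ↦ P(X₀ + ξ, η X₁)` (inhomogeneous `Roy2013.tau`). -/
def transl (ξ η : ℂ) : MvPolynomial (Fin 2) ℂ →ₐ[ℂ] MvPolynomial (Fin 2) ℂ :=
  aeval ![C ξ + X 0, C η * X 1]

/-- FAKE EXPONENTIAL (first lemma of card `fake-exponential-frobenius`): on the degree box
`V = ℂ[X₀]_{≤D₀} ⊗ ℂ[X₁]_{≤D₁}` — a CYCLIC `ℂ[D]`-module with annihilator
`Ω(D) = ∏_{b ≤ D₁} (D - b)^{D₀+1}` (Hermite's polynomial) — translation by `(ξ, η)` commutes with `D`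
and therefore IS a polynomial `a_{ξ,η}(D)` of degree `< d = (D₀+1)(D₁+1)` in `D`; `a_{ξ,η}` is the
Hermite interpolant with germ `η^b e^{ξ(z-b)} mod (z-b)^{D₀+1}` at each node `b` (equal to `e^{ξ z}`
iff `η = e^{ξ}`: the "fake exponential" of the point). Consequence: `(D^k P)(m·y, α^m) =
λ₀(z^k a^m S^P)` in the Frobenius algebra `ℚ[z]/(Ω)`. -/
def TranslationIsPolynomialInD : Prop :=
  ∀ (D₀ D₁ : ℕ) (ξ η : ℂ), ∃ a : Polynomial ℂ, a.natDegree < (D₀ + 1) * (D₁ + 1) ∧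
    ∀ P : MvPolynomial (Fin 2) ℂ, P.degreeOf 0 ≤ D₀ → P.degreeOf 1 ≤ D₁ →
      transl ξ η P =
        Polynomial.aeval (R := ℂ) (A := Module.End ℂ (MvPolynomial (Fin 2) ℂ))
          (royDerC : Derivation ℂ (MvPolynomial (Fin 2) ℂ) (MvPolynomial (Fin 2) ℂ)).toLinearMap a P

/-- ONE-POINT PERFECTNESS (Hermite 1873; first lemma of card `shadow-surjectivity`): the `d` jets
`(D^k P)(0, 1)`, `k < d = (D₀+1)(D₁+1)`, determine `P` in the degree box — i.e. the Frobenius form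
`λ₀ = ev_{(0,1)}` of `ℚ[D]/(Ω)` is non-degenerate and `P ↦ S^P` is a bijection onto `ℚ[z]_{<d}`. -/
def OnePointPerfectness : Prop :=
  ∀ (D₀ D₁ : ℕ) (P : MvPolynomial (Fin 2) ℤ), P.degreeOf 0 ≤ D₀ → P.degreeOf 1 ≤ D₁ →
    (∀ k < (D₀ + 1) * (D₁ + 1), MvPolynomial.aeval ![(0 : ℂ), 1] (royD^[k] P) = 0) → P = 0

/-- TWISTED NON-VANISHING = SHADOW SURJECTIVITY in values form (card `shadow-surjectivity`; it is
(E) dualised over the number field, hence equivalent to `ExactLindemann`): for every `ℚ`-linear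
`θ : F → ℚ` with `θ 1 ≠ 0` and every non-zero `P` in the degree box, some box value has
`θ((D^k P)(m·y, α^m)) ≠ 0`. Equivalently the `ℚ[z]_{≤K}`-span of the Galois shadows
`t_m = θ(a^m) ∈ ℚ[z]/(Ω)` (`m` in the box) is all of `ℚ[z]/(Ω)`. -/
def TwistedNonVanishing : Prop :=
  ∀ (n : ℕ) (F : IntermediateField ℚ ℂ) [FiniteDimensional ℚ F] (y α : Fin n → F), 1 ≤ n →
    LinearIndependent ℚ y → (∀ j, α j ≠ 0) →
    ∀ s₀ s₁ t₀ t₁ u : ℝ, RoyAdmissible s₀ s₁ t₀ t₁ u →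
    ∀ᶠ N : ℕ in atTop, ∀ (θ : F →ₗ[ℚ] ℚ) (P : MvPolynomial (Fin 2) ℤ), θ 1 ≠ 0 → P ≠ 0 →
      (P.degreeOf 0 : ℝ) ≤ (N : ℝ) ^ t₀ → (P.degreeOf 1 : ℝ) ≤ (N : ℝ) ^ t₁ →
      ∃ (k : ℕ) (m : Fin n → ℕ), (k : ℝ) ≤ (N : ℝ) ^ s₀ ∧ (∀ j, (m j : ℝ) ≤ (N : ℝ) ^ s₁) ∧
        θ (MvPolynomial.aeval (R := ℤ) ![∑ j, ((m j : ℕ) : F) * y j, ∏ j, α j ^ (m j)]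
          (royD^[k] P)) ≠ 0

end Summit.Schanuel.Schanuel.Cruxes.PolarLindemann.Ideate1

end
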